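import Summits.RiemannHypothesis.RiemannHypothesis.Theorems.JensenLogBandXiDerivBandRealAllRates
import Summits.RiemannHypothesis.RiemannHypothesis.Theorems.JensenLogBandOneCrux
import HarnessLib

/-!
# The EDGE crux of route JensenLogBand from the BAND (stmt-RiemannHypothesis-19912, RH-FREE)

RH ladder column JENSEN, rung J-P(P3) «log band», route «JensenLogBand», support item
`XiDerivEdgeReal` (stmt-RiemannHypothesis-19912, rank 2): every zero `z` of `ξ₁⁽ⁿ⁾` with
`chainRadius n ≤ ‖z‖ ≤ 64(n/log n)²` is real, for all large `n`. It is the one-line corollary of the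
BAND crux `XiDerivBandRealAllRates` (stmt-RiemannHypothesis-19913, proved by the BAND lead
rh-jensen-prover g8: `…Theorems.XiDerivBandRealAllRates_proof`) through the route-vocabulary
reduction `LogBand.OneCrux.xiDerivEdgeReal_of_xiDerivBandRealAllRates` (idea-2 g7, the BAND at the
single rate `c = 1` and `RealnessLadder.edgeReal_of_bandReal`). RH-FREE. WHAT THIS IS NOT: realness of
the zeros of high derivatives of `ξ` in an annulus — a hyperbolicity range with `N(d) → ∞`, inside
Farmer's class; nothing here bears on zeros of `ζ` off the line or the truth of RH.
(prover-rh-jensen-eng-2-g7-0, 2026-08-27.)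
-/

noncomputable section

-- single-problem summit: `Summit.RiemannHypothesis.RiemannHypothesis.…` is the tree convention
set_option linter.dupNamespace false

namespace Summit.RiemannHypothesis.RiemannHypothesis.Theorems

/-- **The EDGE crux `XiDerivEdgeReal` holds** (from the BAND crux, RH-FREE). [folklore] -/
theorem XiDerivEdgeReal_proof :
    Summit.RiemannHypothesis.RiemannHypothesis.Theses.JensenLogBand.XiDerivEdgeReal :=
  JensenPolynomials.LogBand.OneCrux.xiDerivEdgeReal_of_xiDerivBandRealAllRates
    XiDerivBandRealAllRates_proof

end Summit.RiemannHypothesis.RiemannHypothesis.Theorems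

end
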